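import Literature.Dynamics.Ergodic.ToralEndomorphismsPerronFrobenius
import Literature.AlgebraicGeometry.HodgeTheory.AbelianVarietyExactEndomorphisms
import Literature.AlgebraicGeometry.HodgeTheory.AbelianVarietyIsogenyDegreeSign
import HarnessLib

/-!
# The Perron–Frobenius operator of an isogeny of a complex abelian variety is the fibre average
# `P_{f(ℂ)} g (P) = (deg f)⁻¹ Σ_{f(ℂ) Q = P} g(Q)` (Bezuglyi–Jorgensen (1.3)/(1.6))

Lane `lit-hodgefound`, row g22-#2 FILE 2 (prover seat `lit-hodgefound-p31`): the lane file of
`Literature/Dynamics/Ergodic/ToralEndomorphismsPerronFrobenius.lean` (`P_{T_A} f = |det A|⁻¹ Σ_{T_A y = x} f(y)` on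
`𝕋^d`; `P` is a conjugacy invariant), read on the tree's complex tori `X = E/Φ(ℤ^ι)` (`ComplexTorus Φ`,
`ρ(M) = mapMatrix Φ Φ M`) and on the complex points `A(ℂ)` of a complex abelian variety with its Haar probability
measure `μ` (uniformisation `φ : X ≃ A(ℂ)`, `f(ℂ) ∘ φ = φ ∘ ρ(ρ_r(f))`, `μ = φ_* vol`:
`complexAbelianVariety_torusUniformised_holds`, `exists_mapMatrix_comp_eq_of_hom`, `eq_map_volume_of_map_mul_right_eq`).
Sequel of `AbelianVarietyPerronFrobenius.lean` (g21-#11: exactness / mixing of `f(ℂ)` through `P_{f(ℂ)}`), which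
left the operator itself implicit.

## The printed statements

S. Bezuglyi, P. E. T. Jorgensen, *Transfer Operators, Endomorphisms, and Measurable Partitions* (LNM 2217, 2018),
§1.2 (Galaxy text panama:274938036486154, chunks p0012–p0014): eq. (1.3) «`R_σ(f)(x) = Σ_{y ∈ σ⁻¹(x)} W(y) f(y)`» for
an `n`-to-one endomorphism `σ`; Example 1.3 eq. (1.6) «`∫_A P(f) dμ = ∫_{σ⁻¹(A)} f dμ`» (Frobenius–Perron
operators); Example 1.2 (`σ = 2x mod 1`: «`R_σ(f)(x) = ½(f(x/2) + f((x+1)/2))`», `μR_σ = μ`).  Here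
`σ = f(ℂ) : A(ℂ) → A(ℂ)` for an isogeny `f : A → A` of a complex abelian variety, an `n`-to-one group endomorphism
with `n = deg f = |Ker f(ℂ)| = |det ρ_r(f)|` (Lange Prop. 1.1.13 (c), the tree's
`AbelianVariety.natCard_kerPoints_eq_natAbs_det_of_end`), `μ` = the Haar probability measure of `A(ℂ)` (Walters
Thm. 0.13; preserved by `f(ℂ)`, `AbelianVariety.measurePreserving_mapContinuous_iff_isIsogeny`), `P` = the tree's
`perronFrobenius f(ℂ) μ` (Dajani–Kalle Definition 6.1.1), and `W = 1/deg f`.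

## What is formalised (theorems only; no definition, no named fact)

§1 complex tori: `ComplexTorus.perronFrobenius_mapMatrix_ae_eq_finsum_preimage` (`det M ≠ 0`:
`P_{ρ(M)} g = |det M|⁻¹ Σ_{ρ(M) y = x} g(y)` a.e.), its iterate form, and `ComplexTorus.perronFrobenius_nsmul_ae_eq`
(`y ↦ m•y`: `m^{-|ι|} Σ_{m y = x} g(y)`).  §2 `A(ℂ)`: **`AbelianVariety.perronFrobenius_mapContinuous_ae_eq_finsum_preimage`**
(for an isogeny `f` and measurable `g ∈ L¹(μ)`: `P_{f(ℂ)} g (P) = (deg f)⁻¹ Σ_{f(ℂ) Q = P} g(Q)` for `μ`-a.e. `P`,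
`deg f = Nat.card (Hom.kerPoints (specOver ℂ ℂ) f)`) and `AbelianVariety.perronFrobenius_pow_ae_eq_finsum_preimage`
(`Q ↦ Q^m`, `m ≥ 1`: `m^{-2 dim A} Σ_{Q^m = P} g(Q)`).

## References

* [BezuglyiJorgensen2018] S. Bezuglyi, P. E. T. Jorgensen, LNM 2217 (2018), §1.2 Example 1.2, eqs. (1.3), (1.6)
  (Galaxy text panama:274938036486154, chunks p0012–p0014).
* [LasotaMackey1994] A. Lasota, M. C. Mackey, *Chaos, Fractals, and Noise* (1994), §1.2 eq. (1.2.13), §4.4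
  Example 4.4.2 (Galaxy text panama:430192514301980).
* [DajaniKalle2021] K. Dajani, C. Kalle, *A First Course in Ergodic Theory* (2021), §6.1 Definition 6.1.1 (held
  text chunk p0084).
* [Lange2023AbelianVarietiesComplex] H. Lange, *Abelian Varieties over the Complex Numbers* (2023), §1.1.2
  Prop. 1.1.6, Prop. 1.1.13 (c), Prop. 1.1.14 (PDF pp. 19–22).
* [MumfordAV1970] D. Mumford, *Abelian Varieties* (1970), §1 (1)–(2).
* [Walters1982] P. Walters, *An Introduction to Ergodic Theory*, GTM 79 (1982), §0.6 Theorem 0.13 (held text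
  chunk p0022).
-/

noncomputable section

-- `ComplexTorus Φ` (for `Φ : ℝ^ι ≃ E`) is the type `ι → ℝ/ℤ = UnitAddTorus ι`; instance paths up to unfolding
set_option backward.isDefEq.respectTransparency false
-- nested instance problems on the carriers (cf. `AbelianVarietyErgodicEndomorphisms.lean`)
set_option maxSynthPendingDepth 3

open scoped Manifold
open CategoryTheory Module Function MeasureTheory MeasureTheory.Measure Set Filter
open Literature.AlgebraicTopology.SingularHomology Literature.NumberTheory.Transcendental
  Literature.NumberTheory.LFunctions Literature.Dynamics.Ergodic
open Literature.AlgebraicGeometry.Motives (ComplexPoints IsSmoothProjective AbelianVariety SchemeOver AlgPoints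
  specOver)
open Literature.AlgebraicGeometry.Motives.AbelianVariety (Hom.kerPoints)

/-! ### §1 Complex tori -/

namespace Literature.Geometry.Kaehler.ComplexTorus

variable {ι : Type*} [Fintype ι] [DecidableEq ι] {E : Type*} [NormedAddCommGroup E] [NormedSpace ℂ E]
  (Φ : (ι → ℝ) ≃L[ℝ] E)

/-- **The Perron–Frobenius operator of an endomorphism `ρ(M)` of a complex torus (`det M ≠ 0`, Haar probability
measure) is the fibre average**: `P_{ρ(M)} g (x) = |det M|⁻¹ Σ_{ρ(M) y = x} g(y)` for a.e. `x`, for measurable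
`g ∈ L¹`. [cite: BezuglyiJorgensen2018, §1.2 Example 1.2, eqs. (1.3), (1.6) (Galaxy text panama:274938036486154, chunks p0012–p0014)]
[cite: DajaniKalle2021, §6.1 Definition 6.1.1 (held text chunk p0084)] -/
theorem perronFrobenius_mapMatrix_ae_eq_finsum_preimage {M : Matrix ι ι ℤ} (hM : M.det ≠ 0) {g : ComplexTorus Φ → ℝ}
    (hgm : Measurable g) (hg : Integrable g volume) :
    perronFrobenius (mapMatrix Φ Φ M) volume g =ᵐ[volume]
      fun x ↦ (M.det.natAbs : ℝ)⁻¹ * ∑ᶠ y ∈ (mapMatrix Φ Φ M) ⁻¹' {x}, g y :=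
  ToralEndomorphism.perronFrobenius_ae_eq_finsum_preimage M (T := mapMatrix Φ Φ M) (mapMatrix_apply M) hM hgm hg

/-- **Iterates**: `P_{ρ(M)}ⁿ g (x) = |det M|⁻ⁿ Σ_{ρ(M)ⁿ y = x} g(y)` a.e.
[cite: BezuglyiJorgensen2018, §1.2 eq. (1.3) (Galaxy text panama:274938036486154, chunk p0013)]
[cite: DajaniKalle2021, §6.1 Proposition 6.1.2 (held text chunk p0084)] -/
theorem iterate_perronFrobenius_mapMatrix_ae_eq_finsum_preimage {M : Matrix ι ι ℤ} (hM : M.det ≠ 0)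
    {g : ComplexTorus Φ → ℝ} (hgm : Measurable g) (hg : Integrable g volume) (n : ℕ) :
    (perronFrobenius (mapMatrix Φ Φ M) volume)^[n] g =ᵐ[volume]
      fun x ↦ ((M.det.natAbs : ℝ) ^ n)⁻¹ * ∑ᶠ y ∈ ((mapMatrix Φ Φ M)^[n]) ⁻¹' {x}, g y :=
  ToralEndomorphism.iterate_perronFrobenius_ae_eq_finsum_preimage M (T := mapMatrix Φ Φ M) (mapMatrix_apply M) hM
    hgm hg n

omit [DecidableEq ι] in
/-- **Multiplication by `m ≥ 1` on a complex torus**: `P_{m·} g (x) = m^{-|ι|} Σ_{m y = x} g(y)` a.e.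
(`|ι| = 2 dim X`). [cite: LasotaMackey1994, §1.2 eq. (1.2.13) and §4.4 Example 4.4.2 (Galaxy text panama:430192514301980, chars 150000–172000)]
[cite: BezuglyiJorgensen2018, §1.2 Example 1.2 eq. (1.3) (Galaxy text panama:274938036486154, chunks p0012–p0013)] -/
theorem perronFrobenius_nsmul_ae_eq_finsum_preimage {m : ℕ} (hm : 0 < m) {g : ComplexTorus Φ → ℝ}
    (hgm : Measurable g) (hg : Integrable g volume) :
    perronFrobenius (fun y : ComplexTorus Φ ↦ m • y) volume g =ᵐ[volume]
      fun x ↦ ((m : ℝ) ^ Fintype.card ι)⁻¹ * ∑ᶠ y ∈ (fun z : ComplexTorus Φ ↦ m • z) ⁻¹' {x}, g y := by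
  classical
  exact Literature.Dynamics.Ergodic.perronFrobenius_nsmul_ae_eq_finsum_preimage (d := ι) hm hgm hg

end Literature.Geometry.Kaehler.ComplexTorus

/-! ### §2 Complex abelian varieties -/

namespace Literature.AlgebraicGeometry.HodgeTheory

open Literature.Geometry.Kaehler

section Transport

variable (A : AbelianVariety ℂ) {ι : Type} [Fintype ι] [DecidableEq ι]
  {E : Type} [NormedAddCommGroup E] [NormedSpace ℂ E] [FiniteDimensional ℂ E] {Φ : (ι → ℝ) ≃L[ℝ] E}
  {φ : ComplexTorus Φ → ComplexPoints A.X} (hφ : IsAnalytification E A.X A.dim φ)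
  (hadd : ∀ x y, φ (x + y) = φ x * φ y)

omit [DecidableEq ι] in
include hφ in
/-- **`φ` maps the fibre `S⁻¹{x}` onto the fibre `F⁻¹{φ x}`** for maps `S`, `F` with `φ ∘ S = F ∘ φ` (`φ` bijective),
so that `Σ_{F Q = φ x} g(Q) = Σ_{S t = x} g(φ t)`. [cite: Lange2023AbelianVarietiesComplex, §1.1.2 Prop. 1.1.6 (PDF p. 19)] -/
private theorem finsum_preimage_eq_of_semiconj {S : ComplexTorus Φ → ComplexTorus Φ}
    {F : ComplexPoints A.X → ComplexPoints A.X} (hSF : ∀ t, φ (S t) = F (φ t)) (g : ComplexPoints A.X → ℝ)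
    (x : ComplexTorus Φ) : ∑ᶠ Q ∈ F ⁻¹' {φ x}, g Q = ∑ᶠ t ∈ S ⁻¹' {x}, g (φ t) := by
  have himage : φ '' (S ⁻¹' {x}) = F ⁻¹' {φ x} := by
    ext P
    constructor
    · rintro ⟨t, ht, rfl⟩
      have ht' : S t = x := ht
      show F (φ t) ∈ ({φ x} : Set (ComplexPoints A.X))
      rw [← hSF t, ht']
      exact Set.mem_singleton _
    · intro hP
      obtain ⟨t, rfl⟩ := hφ.isHomeomorph.surjective P
      refine ⟨t, ?_, rfl⟩
      have h : φ (S t) = φ x := by rw [hSF t]; exact hP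
      exact hφ.isHomeomorph.injective h
  rw [← himage, finsum_mem_image hφ.isHomeomorph.injective.injOn]

omit [DecidableEq ι] in
include hφ hadd in
/-- **Transport of `P` along the uniformisation.** For `μ` the Haar probability measure of `A(ℂ)` (`μ = φ_* vol`),
maps `S` on `X` and `F` on `A(ℂ)` with `φ ∘ S = F ∘ φ`, `S` Haar-non-singular and `F` `μ`-non-singular, a weight
`c` and a measurable `g ∈ L¹(μ)`: if `P_S (g ∘ φ) = c · Σ_{S t = ·} (g ∘ φ)(t)` vol-a.e. then
`P_F g = c · Σ_{F Q = ·} g(Q)` `μ`-a.e. (`P` is a conjugacy invariant, `perronFrobenius_map_comp_ae_eq`).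
[cite: BezuglyiJorgensen2018, §1.2 Example 1.3 eq. (1.6) (Galaxy text panama:274938036486154, chunk p0014)]
[cite: Walters1982, §0.6 Theorem 0.13 (held text chunk p0022)] -/
private theorem perronFrobenius_ae_eq_of_semiconj [MeasurableSpace (ComplexPoints A.X)]
    [BorelSpace (ComplexPoints A.X)] (μ : Measure (ComplexPoints A.X)) [IsProbabilityMeasure μ]
    (hμ : ∀ Q : A.Points ℂ, Measure.map (fun P : A.Points ℂ ↦ P * Q) μ = μ)
    {S : ComplexTorus Φ → ComplexTorus Φ} {F : ComplexPoints A.X → ComplexPoints A.X}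
    (hS : QuasiMeasurePreserving S volume volume) (hF : QuasiMeasurePreserving F μ μ) (hSF : ∀ t, φ (S t) = F (φ t))
    {g : ComplexPoints A.X → ℝ} (hg : Integrable g μ) (c : ℝ)
    (hPS : perronFrobenius S volume (g ∘ φ) =ᵐ[volume] fun x ↦ c * ∑ᶠ t ∈ S ⁻¹' {x}, g (φ t)) :
    perronFrobenius F μ g =ᵐ[μ] fun P ↦ c * ∑ᶠ Q ∈ F ⁻¹' {P}, g Q := by
  have hμφ := eq_map_volume_of_map_mul_right_eq A hφ hadd μ hμ
  set e := hφ.homeomorph.toMeasurableEquiv with he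
  have hecoe : (e : ComplexTorus Φ → ComplexPoints A.X) = φ := by
    rw [he, Homeomorph.toMeasurableEquiv_coe, IsAnalytification.coe_homeomorph]
  haveI : IsFiniteMeasure (volume : Measure (ComplexTorus Φ)) := by
    haveI : IsProbabilityMeasure (volume : Measure (ComplexTorus Φ)) :=
      Literature.NumberTheory.DiophantineApproximation.KroneckerWeyl.isProbabilityMeasure_volume_unitAddTorus
    infer_instance
  have hμe : μ = Measure.map e volume := by rw [hecoe]; exact hμφ
  have hF' : QuasiMeasurePreserving F (Measure.map e volume) (Measure.map e volume) := by rwa [← hμe]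
  have hg' : Integrable g (Measure.map e volume) := by rwa [← hμe]
  have hconj : ∀ t, e (S t) = F (e t) := fun t ↦ by rw [hecoe]; exact hSF t
  -- `P_F g ∘ φ = P_S (g ∘ φ) = (fibre average of g) ∘ φ` vol-a.e.
  have h1 := perronFrobenius_map_comp_ae_eq e hS hF' hconj hg'
  rw [← hμe, hecoe] at h1
  have h2 : (fun t ↦ perronFrobenius F μ g (φ t)) =ᵐ[volume]
      fun t ↦ (fun P ↦ c * ∑ᶠ Q ∈ F ⁻¹' {P}, g Q) (φ t) := by
    filter_upwards [h1, hPS] with t ht ht'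
    rw [Function.comp_apply] at ht
    rw [ht, ht']
    rw [finsum_preimage_eq_of_semiconj A hφ hSF g t]
  -- descend along `e`: `μ = e_* vol`
  have h3 : ∀ᶠ P in Filter.map e (ae volume), perronFrobenius F μ g P = c * ∑ᶠ Q ∈ F ⁻¹' {P}, g Q := by
    rw [Filter.eventually_map, hecoe]
    exact h2
  rw [MeasurableEquiv.map_ae, ← hμe] at h3
  exact h3

end Transport

section Haar

variable (A : AbelianVariety ℂ) (f : A ⟶ A) [MeasurableSpace (ComplexPoints A.X)] [BorelSpace (ComplexPoints A.X)]
  (μ : Measure (ComplexPoints A.X)) [IsProbabilityMeasure μ]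
  (hμ : ∀ Q : A.Points ℂ, Measure.map (fun P : A.Points ℂ ↦ P * Q) μ = μ)

include hμ in
/-- **The Perron–Frobenius operator of an isogeny of a complex abelian variety is the fibre average.** For an
isogeny `f : A → A`, the Haar probability measure `μ` of `A(ℂ)` and a measurable `g ∈ L¹(μ)`:
**`P_{f(ℂ)} g (P) = (deg f)⁻¹ Σ_{f(ℂ) Q = P} g(Q)` for `μ`-a.e. `P`**, where `deg f = |Ker f(ℂ)|`
(`Nat.card (Hom.kerPoints (specOver ℂ ℂ) f)` `= |det ρ_r(f)|`, Prop. 1.1.13 (c)) is the number of points in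
every fibre — Bezuglyi–Jorgensen's transfer operator (1.3) with constant weight `W = 1/deg f` is the
Frobenius–Perron operator (1.6) of `(A(ℂ), 𝓑, μ, f(ℂ))`.  Uniformise (`f(ℂ) ∘ φ = φ ∘ ρ(M)`, `μ = φ_* vol`), apply
the torus statement to `g ∘ φ` and transport (`P` is a conjugacy invariant).
[cite: BezuglyiJorgensen2018, §1.2 Example 1.2, eqs. (1.3), (1.6) (Galaxy text panama:274938036486154, chunks p0012–p0014)]
[cite: DajaniKalle2021, §6.1 Definition 6.1.1 (held text chunk p0084)]
[cite: Lange2023AbelianVarietiesComplex, §1.1.2 Prop. 1.1.6 and Prop. 1.1.13 (c) (PDF pp. 19, 22)]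
[cite: Walters1982, §0.6 Theorem 0.13 (held text chunk p0022)] -/
theorem AbelianVariety.perronFrobenius_mapContinuous_ae_eq_finsum_preimage (hf : Motives.AbelianVariety.IsIsogeny f)
    {g : ComplexPoints A.X → ℝ} (hgm : Measurable g) (hg : Integrable g μ) :
    perronFrobenius (AlgPoints.mapContinuous (L := ℂ) f.hom.hom.hom) μ g =ᵐ[μ]
      fun P ↦ (Nat.card (Hom.kerPoints (specOver ℂ ℂ) f) : ℝ)⁻¹ *
        ∑ᶠ Q ∈ (AlgPoints.mapContinuous (L := ℂ) f.hom.hom.hom) ⁻¹' {P}, g Q := by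
  obtain ⟨ι, _, _, Φ, φ, hφ, hadd⟩ := complexAbelianVariety_torusUniformised_holds A
  obtain ⟨M, hM⟩ := exists_mapMatrix_comp_eq_of_hom Φ Φ ⟨φ, hφ.isHomeomorph.continuous⟩ hφ hadd
    ⟨φ, hφ.isHomeomorph.continuous⟩ hφ hadd f
  have hM' : ∀ t, φ (ComplexTorus.mapMatrix Φ Φ M t) = AlgPoints.mapContinuous (L := ℂ) f.hom.hom.hom (φ t) :=
    fun t ↦ hM t
  have hdet : M.det ≠ 0 := by
    rw [← det_singularHomology_map_one Φ A ⟨φ, hφ.isHomeomorph.continuous⟩ hφ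
      (AlgPoints.mapContinuous (L := ℂ) f.hom.hom.hom) M hM]
    exact (AbelianVariety.isIsogeny_iff_det_singularHomology_map_one_ne_zero f).1 hf
  have hdeg : Nat.card (Hom.kerPoints (specOver ℂ ℂ) f) = M.det.natAbs := by
    rw [AbelianVariety.natCard_kerPoints_eq_natAbs_det_of_end f,
      det_singularHomology_map_one Φ A ⟨φ, hφ.isHomeomorph.continuous⟩ hφ
        (AlgPoints.mapContinuous (L := ℂ) f.hom.hom.hom) M hM]
  have hμφ := eq_map_volume_of_map_mul_right_eq A hφ hadd μ hμ
  have hφm : Measurable φ := hφ.isHomeomorph.continuous.measurable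
  -- the torus statement for `g ∘ φ`
  have hgφ : Integrable (g ∘ φ) (volume : Measure (ComplexTorus Φ)) := by
    rw [hμφ] at hg
    exact (integrable_map_measure hg.aestronglyMeasurable hφm.aemeasurable).1 hg
  have hPS := ComplexTorus.perronFrobenius_mapMatrix_ae_eq_finsum_preimage Φ hdet (hgm.comp hφm) hgφ
  rw [hdeg]
  exact perronFrobenius_ae_eq_of_semiconj A hφ hadd μ hμ
    (ToralEndomorphism.measurePreserving M (T := ComplexTorus.mapMatrix Φ Φ M) (ComplexTorus.mapMatrix_apply M)
      hdet).quasiMeasurePreserving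
    ((AbelianVariety.measurePreserving_mapContinuous_iff_isIsogeny A f μ hμ).2 hf).quasiMeasurePreserving hM' hg
    ((M.det.natAbs : ℝ)⁻¹) hPS

include hμ in
/-- **The Perron–Frobenius operator of `Q ↦ Q^m` (`m ≥ 1`) on `A(ℂ)`: `P g (P) = m^{-2 dim A} Σ_{Q^m = P} g(Q)`
for `μ`-a.e. `P`** (each fibre is a coset of `A[m](ℂ)`, `m^{2 dim A}` points, Prop. 1.1.14; Lasota–Mackey's (1.2.13)
on the complex torus `A(ℂ)`). [cite: LasotaMackey1994, §1.2 eq. (1.2.13) and §4.4 Example 4.4.2 (Galaxy text panama:430192514301980, chars 150000–172000)]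
[cite: BezuglyiJorgensen2018, §1.2 Example 1.2 eq. (1.3) (Galaxy text panama:274938036486154, chunks p0012–p0013)]
[cite: Lange2023AbelianVarietiesComplex, §1.1.1 and §1.1.2 Prop. 1.1.14 (PDF pp. 16, 22)] -/
theorem AbelianVariety.perronFrobenius_pow_ae_eq_finsum_preimage {m : ℕ} (hm : 0 < m)
    {g : ComplexPoints A.X → ℝ} (hgm : Measurable g) (hg : Integrable g μ) :
    perronFrobenius (fun Q : A.Points ℂ ↦ Q ^ m) μ g =ᵐ[μ]
      fun P ↦ ((m : ℝ) ^ (2 * A.dim))⁻¹ * ∑ᶠ Q ∈ (fun Q : A.Points ℂ ↦ Q ^ m) ⁻¹' {P}, g Q := by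
  obtain ⟨ι, _, _, Φ, φ, hφ, hadd⟩ := complexAbelianVariety_torusUniformised_holds A
  have hι : Fintype.card ι = 2 * A.dim := by
    rw [← hφ.finrank_eq, ← finrank_real_of_complex (Fin A.dim → ℂ), ← LinearEquiv.finrank_eq Φ.toLinearEquiv,
      Module.finrank_fintype_fun_eq_card]
  have hμφ := eq_map_volume_of_map_mul_right_eq A hφ hadd μ hμ
  have hφm : Measurable φ := hφ.isHomeomorph.continuous.measurable
  have hpow' : ∀ (n : ℕ) (t : ComplexTorus Φ), φ (n • t) = φ t ^ n := by
    intro n t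
    induction n with
    | zero =>
      have h := hadd 0 0
      rw [add_zero] at h
      rw [zero_nsmul, pow_zero]
      exact mul_eq_left.1 h.symm
    | succ n ih => rw [succ_nsmul, hadd, ih, pow_succ]
  have hpow : ∀ t : ComplexTorus Φ, φ (m • t) = φ t ^ m := hpow' m
  -- `Q ↦ Q^m` preserves `μ`: it is conjugate to `t ↦ m•t`, which preserves the Haar measure of the torus
  set e := hφ.homeomorph.toMeasurableEquiv with he
  have hecoe : (e : ComplexTorus Φ → ComplexPoints A.X) = φ := by
    rw [he, Homeomorph.toMeasurableEquiv_coe, IsAnalytification.coe_homeomorph]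
  have heP : MeasurePreserving e volume μ := ⟨e.measurable, by rw [hecoe, hμφ]⟩
  classical
  have hTm : ∀ (x : ComplexTorus Φ) (i : ι), (m • x) i = ∑ j, (((m : ℤ) • (1 : Matrix ι ι ℤ)) i j) • x j :=
    fun x i ↦ by
      rw [show (m • x) i = m • x i from rfl]
      simp only [Matrix.smul_apply, Matrix.one_apply, smul_eq_mul, mul_ite, mul_one, mul_zero, ite_smul,
        zero_smul, Finset.sum_ite_eq, Finset.mem_univ, if_true, natCast_zsmul]
  have hdet : (((m : ℤ) • (1 : Matrix ι ι ℤ))).det ≠ 0 := by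
    rw [Matrix.det_smul, Matrix.det_one, mul_one]
    exact pow_ne_zero _ (by exact_mod_cast hm.ne')
  have hS : MeasurePreserving (fun t : ComplexTorus Φ ↦ m • t) volume volume :=
    ToralEndomorphism.measurePreserving ((m : ℤ) • (1 : Matrix ι ι ℤ)) (T := fun t : ComplexTorus Φ ↦ m • t) hTm hdet
  have hF : MeasurePreserving (fun Q : A.Points ℂ ↦ Q ^ m) μ μ := by
    have hcomp : (fun Q : A.Points ℂ ↦ Q ^ m) = e ∘ (fun t : ComplexTorus Φ ↦ m • t) ∘ e.symm := by
      funext Q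
      simp only [Function.comp_apply, hecoe, hpow]
      congr 1
      have h := e.apply_symm_apply Q
      rw [hecoe] at h
      exact h.symm
    rw [hcomp]
    exact heP.comp (hS.comp heP.symm)
  have hgφ : Integrable (g ∘ φ) (volume : Measure (ComplexTorus Φ)) := by
    rw [hμφ] at hg
    exact (integrable_map_measure hg.aestronglyMeasurable hφm.aemeasurable).1 hg
  have hPS := ComplexTorus.perronFrobenius_nsmul_ae_eq_finsum_preimage Φ hm (hgm.comp hφm) hgφ
  rw [hι] at hPS
  exact perronFrobenius_ae_eq_of_semiconj A hφ hadd μ hμ hS.quasiMeasurePreserving hF.quasiMeasurePreserving hpow hg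
    (((m : ℝ) ^ (2 * A.dim))⁻¹) hPS

end Haar

end Literature.AlgebraicGeometry.HodgeTheory
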